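import Mathlib
import HarnessLib
import Summits.HubbardSuperconductivity.HubbardSuperconductivity.Theorems.KLProgrammeC4aPairSumJetsL1

/-!
# Route `KLProgramme` — crux C4a, (L3) the particle–hole EXCHANGE class: lower comparability of the pair-difference path at the FORWARD configuration
# and the assembled `CoMovingJetsL1 4` with constant, scale-free dominators for `V(k,q) = B(k − q)`

Cell `gate-hubbard-kl`, lane hubbard-kl-c4a-1 (g5); helper for stub (C) `stub_twoLeg_curvature` of the engine-flow child `KLRegimeEngineV17F2`
(stmt-HubbardSuperconductivity-20437); memo HOME/hubbard-kl-c4a-1/C4A-PLAN.md §22.6.  Twin of `…C4aPathComparability` + `…C4aPairSumJetsL1` for the path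
`D_{ρ,ϑ,θ}(t) = Φ(0,θ+t) − Φ(ρ,ϑ+θ+t)`, rigid at `ϑ ≡ 0 (mod 2π)`: the chart distance is `δ = |ρ| + min(|ϑ|, |ϑ − 2π|)` on `[0, 2π]`; the ⊥/∥ components of
`D(0) = u₀(θ)dir θ − u_ρ(φ)dir φ` are `−u₀ sin ϑ` and `u₀ cos ϑ − u_ρ`; the SAME constant `pairSumLowerConst r` works.

* §1 `pairDiffPath_zero_proj_perp/_par`, **`norm_pairDiffPath_zero_ge`**: `pairSumLowerConst r·(|ρ| + min(|ϑ|,|ϑ−2π|)) ≤ ‖D_{ρ,ϑ,θ}(0)‖` (`|ρ| < r`, `ϑ ∈ [0,2π]`);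
* §2 **`coMovingJetsL1_pairDiff_of_inversePower`**: for `B` of class `C⁴` with `‖B‖ ≤ Cb0`, `‖DᵏB(p)‖ ≤ Cb·(max(c′‖p‖,Λ)^k)⁻¹` (`1 ≤ k ≤ 4`) and the chart's radial
  rows of orders 2, 3: `CoMovingJetsL1 4 (fun i _ => ppJetDominator Cb Cb0 x Λ (2·msD A₃ A₄ 4) i) r μ K (fun k q => B (k − q))`, same `x` as the pp class.

Proved composition keyed by the frame's sizes as `…C4aPathJets`; nothing about the Hubbard model's sizes; nothing asserts superconductivity.
References: FST II CPAM 51 (1998) §3 Thm 3.5; BGM 2006 §2.4 (2.36)–(2.41) [cite: BenfattoGiulianiMastropietro2006].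
-/

noncomputable section

namespace Summit.HubbardSuperconductivity.HubbardSuperconductivity.Theorems.C4a

set_option linter.dupNamespace false -- summit = problem name (single-conjunct summit), D-0017

open Real Set MeasureTheory Finset
open scoped ContDiff
open Literature.MathematicalPhysics.QuantumLattice Literature.MathematicalPhysics.QuantumLattice.BandSectorCounting Literature.Probability.LatticeModels
open Summit.HubbardSuperconductivity.HubbardSuperconductivity.Theorems.KLRegimeSplit
open Summit.HubbardSuperconductivity.HubbardSuperconductivity.Theorems.DispersionFlow
open Summit.HubbardSuperconductivity.HubbardSuperconductivity.Theorems.PerturbedFermiCurve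

/-! ## §1 Lower comparability of the pair-difference path at the forward configuration -/

/-- The ⊥-component of `D_{ρ,ϑ,θ}(0)`: `−D₀ sin φ + D₁ cos φ = −u_K(μ;θ)·sin ϑ` (`φ = ϑ + θ`). -/
theorem pairDiffPath_zero_proj_perp (μ : ℝ) (K : TrigPolyC4v) (ρ ϑ θ : ℝ) :
    (pairDiffPath μ K ρ ϑ θ 0).ofLp 0 * Real.cos (ϑ + θ + π / 2) + (pairDiffPath μ K ρ ϑ θ 0).ofLp 1 * Real.sin (ϑ + θ + π / 2) =
      -(perturbedFermiRadius (fun k : Fin 2 → ℝ => -K.eval k) (μ + 0) θ * Real.sin ϑ) := by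
  rw [pairDiffPath_apply_zero, WithLp.ofLp_sub, Pi.sub_apply, Pi.sub_apply, levelPoint_apply_zero, levelPoint_apply_zero,
    levelPoint_apply_one, levelPoint_apply_one, Real.cos_add_pi_div_two, Real.sin_add_pi_div_two]
  have hs : Real.sin ϑ = Real.sin (ϑ + θ) * Real.cos θ - Real.cos (ϑ + θ) * Real.sin θ := by
    rw [show ϑ = (ϑ + θ) - θ by ring, Real.sin_sub]; ring_nf
  rw [hs]; ring

/-- The ∥-component of `D_{ρ,ϑ,θ}(0)`: `D₀ cos φ + D₁ sin φ = u_K(μ;θ)·cos ϑ − u_K(μ+ρ;φ)` (`φ = ϑ + θ`). -/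
theorem pairDiffPath_zero_proj_par (μ : ℝ) (K : TrigPolyC4v) (ρ ϑ θ : ℝ) :
    (pairDiffPath μ K ρ ϑ θ 0).ofLp 0 * Real.cos (ϑ + θ) + (pairDiffPath μ K ρ ϑ θ 0).ofLp 1 * Real.sin (ϑ + θ) =
      perturbedFermiRadius (fun k : Fin 2 → ℝ => -K.eval k) (μ + 0) θ * Real.cos ϑ -
        perturbedFermiRadius (fun k : Fin 2 → ℝ => -K.eval k) (μ + ρ) (ϑ + θ) := by
  rw [pairDiffPath_apply_zero, WithLp.ofLp_sub, Pi.sub_apply, Pi.sub_apply, levelPoint_apply_zero, levelPoint_apply_zero,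
    levelPoint_apply_one, levelPoint_apply_one]
  have hc : Real.cos ϑ = Real.cos θ * Real.cos (ϑ + θ) + Real.sin θ * Real.sin (ϑ + θ) := by
    rw [show ϑ = (ϑ + θ) - θ by ring, Real.cos_sub]; ring_nf
  rw [hc]
  linear_combination (-perturbedFermiRadius (fun k : Fin 2 → ℝ => -K.eval k) (μ + ρ) (ϑ + θ)) * Real.sin_sq_add_cos_sq (ϑ + θ)

section Sizes

variable {K : TrigPolyC4v} {A : ℝ} (hA : ∀ p : Momentum, ∀ j ≤ 2, ‖iteratedFDeriv ℝ j (frameShift K) p‖ ≤ A) (hA20 : A ≤ 1 / 20)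
  (hd : klCurveD ≤ (bandBounds (show (-4 : ℝ) < -1.1 by norm_num) (show (-1.1 : ℝ) ≤ -0.1 by norm_num)
    (show (-0.1 : ℝ) < 0 by norm_num)).Dtmin - 2 * A)
  {μ r : ℝ} (hr : 0 < r) (hlo : (-1.1 : ℝ) < μ - r - A) (hhi : μ + r + A < -0.1)
  {A₃ A₄ : ℝ} (hA₃ : ∀ p : Momentum, ‖iteratedFDeriv ℝ 3 (frameShift K) p‖ ≤ A₃)
  (hA₄ : ∀ p : Momentum, ‖iteratedFDeriv ℝ 4 (frameShift K) p‖ ≤ A₄)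
include hA hA20 hd hr hlo hhi hA₃ hA₄

/-- **LOWER COMPARABILITY of the pair-difference path (transversality at the forward configuration).**  For `|ρ| < r`, `ϑ ∈ [0, 2π]` and every `θ`:
`pairSumLowerConst r·(|ρ| + min(|ϑ|, |ϑ − 2π|)) ≤ ‖Φ(0,θ) − Φ(ρ,ϑ+θ)‖`. [cite: BenfattoGiulianiMastropietro2006, §2.4 (2.40)–(2.41)] -/
theorem norm_pairDiffPath_zero_ge {ρ : ℝ} (hρ : |ρ| < r) {ϑ : ℝ} (hϑ : ϑ ∈ Icc 0 (2 * π)) (θ : ℝ) :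
    pairSumLowerConst r * (|ρ| + min |ϑ| |ϑ - 2 * π|) ≤ ‖pairDiffPath μ K ρ ϑ θ 0‖ := by
  set B := bandBounds (show (-4 : ℝ) < -1.1 by norm_num) (show (-1.1 : ℝ) ≤ -0.1 by norm_num) (show (-0.1 : ℝ) < 0 by norm_num) with hBdef
  set S := pairDiffPath μ K ρ ϑ θ 0 with hSdef
  set u₀ := perturbedFermiRadius (fun k : Fin 2 → ℝ => -K.eval k) (μ + 0) θ with hu₀
  set uρ := perturbedFermiRadius (fun k : Fin 2 → ℝ => -K.eval k) (μ + ρ) (ϑ + θ) with huρ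
  set u₀φ := perturbedFermiRadius (fun k : Fin 2 → ℝ => -K.eval k) (μ + 0) (ϑ + θ) with hu₀φ
  set c := pairSumLowerConst r with hcdef
  set d := min |ϑ| |ϑ - 2 * π| with hddef
  set C₁ := klCurveR1 + π ^ 2 * Real.sqrt 2 / 4 with hC₁def
  have hπ := Real.pi_pos
  have hρ1 := (abs_lt.1 hρ).1
  have hρ2 := (abs_lt.1 hρ).2
  have humin : 0 < B.umin := B.umin_pos
  have hR1 : 0 ≤ klCurveR1 := klCurveR1_nonneg
  have hC₁ : 0 < C₁ := by positivity
  have hm0lo : (-1.1 : ℝ) ≤ μ + 0 - A := by linarith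
  have hm0hi : μ + 0 + A ≤ -0.1 := by linarith
  have hmρlo : (-1.1 : ℝ) ≤ μ + ρ - A := by linarith
  have hmρhi : μ + ρ + A ≤ -0.1 := by linarith
  have hm0hi' : μ + 0 + A < -0.1 := by linarith
  have hmρhi' : μ + ρ + A < -0.1 := by linarith
  have hu₀min : B.umin ≤ u₀ := umin_le_frameRadius B hA hm0lo hm0hi θ
  have huρmin : B.umin ≤ uρ := umin_le_frameRadius B hA hmρlo hmρhi (ϑ + θ)
  have hu₀le : u₀ ≤ π * Real.sqrt 2 := frameRadius_le B hA hm0lo hm0hi θ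
  have hu₀pos : 0 < u₀ := humin.trans_le hu₀min
  -- the two projections
  have hperp : u₀ * |Real.sin ϑ| ≤ ‖S‖ := by
    have h := abs_proj_le_norm S (ϑ + θ + π / 2)
    rwa [hSdef, pairDiffPath_zero_proj_perp, abs_neg, abs_mul, abs_of_pos hu₀pos] at h
  have hpar : |u₀ * Real.cos ϑ - uρ| ≤ ‖S‖ := by
    have h := abs_proj_le_norm S (ϑ + θ)
    rwa [hSdef, pairDiffPath_zero_proj_par] at h
  -- bookkeeping on d and c
  have hϑabs : |ϑ| = ϑ := abs_of_nonneg hϑ.1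
  have hϑabs' : |ϑ - 2 * π| = 2 * π - ϑ := by rw [abs_sub_comm]; exact abs_of_nonneg (by linarith [hϑ.2])
  have hdle : d ≤ π := by
    rcases le_or_gt ϑ π with h | h
    · exact (min_le_left _ _).trans (by rw [hϑabs]; exact h)
    · exact (min_le_right _ _).trans (by rw [hϑabs']; linarith)
  have hd0 : 0 ≤ d := le_min (abs_nonneg _) (abs_nonneg _)
  have hc1 : c ≤ B.umin / (r + π) := min_le_left _ _
  have hc2 : c ≤ B.umin / π := (min_le_right _ _).trans (min_le_left _ _)
  have hc3 : c ≤ 10 / 164 := ((min_le_right _ _).trans (min_le_right _ _)).trans (min_le_left _ _)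
  have hc4 : c ≤ 10 * B.umin / (82 * π * C₁) := ((min_le_right _ _).trans (min_le_right _ _)).trans (min_le_right _ _)
  have hc0 : 0 < c := pairSumLowerConst_pos hr
  rcases le_or_gt (π / 2) d with hfar | hfar
  · -- far from the forward configuration: `cos ϑ ≤ 0`, the ∥-component alone is `≥ u_min`
    have h1d : π / 2 ≤ ϑ := by have := hfar.trans (min_le_left _ _); rwa [hϑabs] at this
    have h2d : ϑ ≤ 3 * π / 2 := by have := hfar.trans (min_le_right _ _); rw [hϑabs'] at this; linarith
    have hcos : Real.cos ϑ ≤ 0 := by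
      have h : 0 ≤ Real.cos (ϑ - π) := Real.cos_nonneg_of_mem_Icc ⟨by linarith, by linarith⟩
      rw [Real.cos_sub_pi] at h; linarith
    have h1 : B.umin ≤ ‖S‖ := by
      refine le_trans ?_ hpar
      have h0 : u₀ * Real.cos ϑ ≤ 0 := mul_nonpos_of_nonneg_of_nonpos hu₀pos.le hcos
      calc B.umin ≤ -(u₀ * Real.cos ϑ - uρ) := by linarith
        _ ≤ |u₀ * Real.cos ϑ - uρ| := neg_le_abs _
    have h2 : |ρ| + d ≤ r + π := by linarith [hρ.le]
    calc c * (|ρ| + d) ≤ B.umin / (r + π) * (r + π) := mul_le_mul hc1 h2 (by positivity) (by positivity)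
      _ = B.umin := div_mul_cancel₀ _ (by positivity)
      _ ≤ ‖S‖ := h1
  · -- near the forward configuration: pick the representative angle `e ∈ {ϑ, ϑ − 2π}` with `|e| = d`
    obtain ⟨e, hed, hcose, hsine, hue⟩ : ∃ e : ℝ, |e| = d ∧ Real.cos ϑ = Real.cos e ∧ |Real.sin ϑ| = |Real.sin e| ∧
        u₀φ = perturbedFermiRadius (fun k : Fin 2 → ℝ => -K.eval k) (μ + 0) (e + θ) := by
      rcases le_total |ϑ| |ϑ - 2 * π| with h | h
      · exact ⟨ϑ, (min_eq_left h).symm, rfl, rfl, rfl⟩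
      · refine ⟨ϑ - 2 * π, (min_eq_right h).symm, (Real.cos_sub_two_pi ϑ).symm, by rw [Real.sin_sub_two_pi], ?_⟩
        rw [hu₀φ, show ϑ + θ = (ϑ - 2 * π + θ) + 2 * π by ring, perturbedFermiRadius_add_two_pi]
    have hed' : |e| < π / 2 := by rw [hed]; exact hfar
    -- (⊥): ‖S‖ ≥ (2 u_min/π)·d
    have hsin : 2 / π * d ≤ |Real.sin ϑ| := by
      rw [hsine, ← hed]
      have h1 : 2 / π * |e| ≤ Real.sin |e| := Real.mul_le_sin (abs_nonneg _) hed'.le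
      have h2 : Real.sin |e| ≤ |Real.sin e| := by
        rcases le_total 0 e with h | h
        · rw [abs_of_nonneg h]; exact le_abs_self _
        · rw [abs_of_nonpos h, Real.sin_neg]; exact neg_le_abs _
      exact h1.trans h2
    have hP : B.umin * (2 / π) * d ≤ ‖S‖ := by
      refine le_trans ?_ hperp
      calc B.umin * (2 / π) * d = B.umin * (2 / π * d) := by ring
        _ ≤ u₀ * |Real.sin ϑ| := mul_le_mul hu₀min hsin (by positivity) hu₀pos.le
    -- (∥): ‖S‖ ≥ (10/41)|ρ| − C₁ d
    have hang : |u₀φ - u₀| ≤ klCurveR1 * d := by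
      have h := abs_frameRadius_sub_le_angle hA hA20 hd hA₃ hA₄ hm0lo hm0hi (e + θ) θ
      rwa [← hue, show e + θ - θ = e by ring, hed] at h
    have hcosd : 1 - Real.cos e ≤ d ^ 2 / 2 := by
      have := Real.one_sub_sq_div_two_le_cos (x := e); rw [← sq_abs, hed] at this; linarith
    have hcle : Real.cos e ≤ 1 := Real.cos_le_one _
    have hd2 : d ^ 2 ≤ π / 2 * d := by rw [sq]; exact mul_le_mul_of_nonneg_right hfar.le hd0
    have hCR : klCurveR1 * d ≤ C₁ * d := by
      refine mul_le_mul_of_nonneg_right ?_ hd0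
      rw [hC₁def]; have : 0 ≤ π ^ 2 * Real.sqrt 2 / 4 := by positivity
      linarith
    have hQ : 10 / 41 * |ρ| - C₁ * d ≤ ‖S‖ := by
      refine le_trans ?_ hpar
      rw [hcose]
      rcases le_or_gt 0 ρ with hρ0 | hρ0
      · -- ρ ≥ 0: uρ − u₀ cos e ≥ uρ − u₀ = (uρ − u₀φ) + (u₀φ − u₀) ≥ (10/41)ρ − R1 d
        have hrad : 10 / 41 * (μ + ρ - (μ + 0)) ≤ uρ - u₀φ :=
          frameRadius_level_sub_ge hA hA20 hd (by linarith) (by linarith) hmρhi' (ϑ + θ)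
        rw [abs_of_nonneg hρ0]
        have h1 : u₀ * Real.cos e ≤ u₀ := by
          have := mul_le_mul_of_nonneg_left hcle hu₀pos.le; linarith
        have h2 : u₀φ - u₀ ≥ -(klCurveR1 * d) := by have := (abs_le.1 hang).1; linarith
        calc 10 / 41 * ρ - C₁ * d ≤ 10 / 41 * ρ - klCurveR1 * d := by linarith
          _ ≤ -(u₀ * Real.cos e - uρ) := by linarith
          _ ≤ |u₀ * Real.cos e - uρ| := neg_le_abs _
      · -- ρ < 0: u₀ cos e − uρ = (u₀ − u₀φ) + (u₀φ − uρ) − u₀ (1 − cos e) ≥ (10/41)|ρ| − R1 d − π√2 d²/2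
        have hrad : 10 / 41 * (μ + 0 - (μ + ρ)) ≤ u₀φ - uρ :=
          frameRadius_level_sub_ge hA hA20 hd (by linarith) (by linarith) hm0hi' (ϑ + θ)
        rw [abs_of_neg hρ0]
        have h2 : u₀φ - u₀ ≤ klCurveR1 * d := (abs_le.1 hang).2
        have h3 : u₀ * (1 - Real.cos e) ≤ π * Real.sqrt 2 * (π / 2 * d) / 2 := by
          have h1c : 0 ≤ 1 - Real.cos e := by linarith
          calc u₀ * (1 - Real.cos e) ≤ (π * Real.sqrt 2) * (d ^ 2 / 2) := mul_le_mul hu₀le hcosd h1c (by positivity)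
            _ ≤ π * Real.sqrt 2 * (π / 2 * d) / 2 := by
                have h0 : 0 ≤ π * Real.sqrt 2 := by positivity
                have := mul_le_mul_of_nonneg_left hd2 h0
                linarith
        calc 10 / 41 * -ρ - C₁ * d = 10 / 41 * -ρ - klCurveR1 * d - π * Real.sqrt 2 * (π / 2 * d) / 2 := by rw [hC₁def]; ring
          _ ≤ (u₀φ - uρ) - (u₀φ - u₀) - u₀ * (1 - Real.cos e) := by linarith
          _ = u₀ * Real.cos e - uρ := by ring
          _ ≤ |u₀ * Real.cos e - uρ| := le_abs_self _
    -- combine (⊥) and (∥)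
    rcases le_or_gt (C₁ * d) (10 / 82 * |ρ|) with hsplit | hsplit
    · have h1 : 10 / 82 * |ρ| ≤ ‖S‖ := by linarith
      have h2 : 10 / 164 * |ρ| + B.umin / π * d ≤ ‖S‖ := by
        have : B.umin / π * d = (B.umin * (2 / π) * d) / 2 := by ring
        rw [this]; linarith
      calc c * (|ρ| + d) = c * |ρ| + c * d := mul_add _ _ _
        _ ≤ 10 / 164 * |ρ| + B.umin / π * d :=
            add_le_add (mul_le_mul_of_nonneg_right hc3 (abs_nonneg _)) (mul_le_mul_of_nonneg_right hc2 hd0)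
        _ ≤ ‖S‖ := h2
    · have h1 : 10 / (82 * C₁) * |ρ| ≤ d := by
        rw [show 10 / (82 * C₁) * |ρ| = (10 / 82 * |ρ|) / C₁ by ring, div_le_iff₀ hC₁]
        linarith
      have h2 : B.umin / π * d + 10 * B.umin / (82 * π * C₁) * |ρ| ≤ ‖S‖ := by
        have h3 : 10 * B.umin / (82 * π * C₁) * |ρ| = B.umin / π * (10 / (82 * C₁) * |ρ|) := by ring
        rw [h3]
        have h4 : B.umin / π * (10 / (82 * C₁) * |ρ|) ≤ B.umin / π * d := mul_le_mul_of_nonneg_left h1 (by positivity)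
        have h5 : B.umin / π * d + B.umin / π * d = B.umin * (2 / π) * d := by ring
        linarith
      calc c * (|ρ| + d) = c * d + c * |ρ| := by ring
        _ ≤ B.umin / π * d + 10 * B.umin / (82 * π * C₁) * |ρ| :=
            add_le_add (mul_le_mul_of_nonneg_right hc2 hd0) (mul_le_mul_of_nonneg_right hc4 (abs_nonneg _))
        _ ≤ ‖S‖ := h2

/-! ## §2 The assembled ph-exchange dominators -/

/-- **(L3) FOR THE PARTICLE–HOLE EXCHANGE CLASS, ASSEMBLED** (twin of `coMovingJetsL1_pairSum_of_inversePower`): same hypotheses on `B` and the radial rows;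
`CoMovingJetsL1 4 (fun i _ => ppJetDominator Cb Cb0 x Λ (2·msD A₃ A₄ 4) i) r μ K (fun k q => B (k − q))`. [cite: BenfattoGiulianiMastropietro2006, §2.4 (2.36)–(2.41)] -/
theorem coMovingJetsL1_pairDiff_of_inversePower {Bf : Momentum → ℂ} (hB : ContDiff ℝ 4 Bf) {Cb Cb0 c' Λ Lrad₂ Lrad₃ : ℝ} (hCb : 0 ≤ Cb)
    (hc' : 0 < c') (hΛ : 0 < Λ) (hL₂ : 0 ≤ Lrad₂)
    (hBk : ∀ p : Momentum, ∀ k, 1 ≤ k → k ≤ 4 → ‖iteratedFDeriv ℝ k Bf p‖ ≤ Cb * ((max (c' * ‖p‖) Λ) ^ k)⁻¹)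
    (hB0 : ∀ p : Momentum, ‖Bf p‖ ≤ Cb0)
    (hrow₂ : ∀ ρ : ℝ, |ρ| < r → ∀ s : ℝ, ‖iteratedDeriv 2 (levelPoint μ K ρ) s - iteratedDeriv 2 (levelPoint μ K 0) s‖ ≤ Lrad₂ * |ρ|)
    (hrow₃ : ∀ ρ : ℝ, |ρ| < r → ∀ s : ℝ, ‖iteratedDeriv 3 (levelPoint μ K ρ) s - iteratedDeriv 3 (levelPoint μ K 0) s‖ ≤ Lrad₃ * |ρ|) :
    CoMovingJetsL1 4
      (fun i _ => ppJetDominator Cb Cb0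
        (max (max (radialRowOneConst A ((bandBounds (show (-4 : ℝ) < -1.1 by norm_num) (show (-1.1 : ℝ) ≤ -0.1 by norm_num)
            (show (-0.1 : ℝ) < 0 by norm_num)).Dtmin - 2 * A)) (msD A₃ A₄ 2)) (max (max Lrad₂ (msD A₃ A₄ 3)) (max Lrad₃ (msD A₃ A₄ 4))) /
          (c' * pairSumLowerConst r)) Λ (2 * msD A₃ A₄ 4) i)
      r μ K (fun k q => Bf (k - q)) := by
  set B₀ := bandBounds (show (-4 : ℝ) < -1.1 by norm_num) (show (-1.1 : ℝ) ≤ -0.1 by norm_num) (show (-0.1 : ℝ) < 0 by norm_num) with hB₀def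
  set dmin := B₀.Dtmin - 2 * A with hdmin
  set c := pairSumLowerConst r with hcdef
  set c₁ := c' * c with hc₁def
  set L := max (max (radialRowOneConst A dmin) (msD A₃ A₄ 2)) (max (max Lrad₂ (msD A₃ A₄ 3)) (max Lrad₃ (msD A₃ A₄ 4))) with hLdef
  set x := L / c₁ with hxdef
  have hADt : 2 * A < B₀.Dtmin := by have := klCurveD_pos; linarith
  have hc0 : 0 < c := pairSumLowerConst_pos hr
  have hc₁0 : 0 < c₁ := mul_pos hc' hc0
  have h0r : |(0 : ℝ)| < r := by simpa using hr
  have hL0 : 0 ≤ L := le_trans hL₂ ((le_max_left _ _).trans ((le_max_left _ _).trans (le_max_right _ _)))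
  have hL1a : radialRowOneConst A dmin ≤ L := (le_max_left _ _).trans (le_max_left _ _)
  have hL1b : msD A₃ A₄ 2 ≤ L := (le_max_right _ _).trans (le_max_left _ _)
  have hL2a : Lrad₂ ≤ L := (le_max_left _ _).trans ((le_max_left _ _).trans (le_max_right _ _))
  have hL2b : msD A₃ A₄ 3 ≤ L := (le_max_right _ _).trans ((le_max_left _ _).trans (le_max_right _ _))
  have hL3a : Lrad₃ ≤ L := (le_max_left _ _).trans ((le_max_right _ _).trans (le_max_right _ _))
  have hL3b : msD A₃ A₄ 4 ≤ L := (le_max_right _ _).trans ((le_max_right _ _).trans (le_max_right _ _))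
  have hD2nn : 0 ≤ msD A₃ A₄ 2 := (norm_nonneg _).trans (norm_iteratedDeriv_levelPoint_le hA hA20 hd hlo hhi hA₃ hA₄ h0r (i := 2) (by norm_num) (by norm_num) 0)
  have hD3nn : 0 ≤ msD A₃ A₄ 3 := (norm_nonneg _).trans (norm_iteratedDeriv_levelPoint_le hA hA20 hd hlo hhi hA₃ hA₄ h0r (i := 3) (by norm_num) (by norm_num) 0)
  have hD4nn : 0 ≤ msD A₃ A₄ 4 := (norm_nonneg _).trans (norm_iteratedDeriv_levelPoint_le hA hA20 hd hlo hhi hA₃ hA₄ h0r (i := 4) (by norm_num) (by norm_num) 0)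
  refine ⟨fun i _ => integrableOn_const_box r _, fun θ ρ ϑ hρ => ?_⟩
  -- periodic reduction of the loop angle to [0, 2π)
  set ϑ₀ := toIcoMod Real.two_pi_pos 0 ϑ with hϑ₀def
  have hϑ₀mem : ϑ₀ ∈ Ico 0 (0 + 2 * π) := toIcoMod_mem_Ico Real.two_pi_pos 0 ϑ
  have hϑ₀Icc : ϑ₀ ∈ Icc 0 (2 * π) := ⟨hϑ₀mem.1, by linarith [hϑ₀mem.2]⟩
  have hϑeq : ϑ₀ + toIcoDiv Real.two_pi_pos 0 ϑ • (2 * π) = ϑ := toIcoMod_add_toIcoDiv_zsmul Real.two_pi_pos 0 ϑ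
  have hco : coMoving μ K (fun k q => Bf (k - q)) θ ρ (ϑ + θ) = coMoving μ K (fun k q => Bf (k - q)) θ ρ (ϑ₀ + θ) := by
    rw [← hϑeq]; exact coMoving_angle_periodic μ K _ θ ρ ϑ₀ _
  rw [hco, coMoving_pairDiff]
  have hS : ContDiff ℝ 4 (pairDiffPath μ K ρ ϑ₀ θ) := contDiff_infty.1 (contDiff_pairDiffPath B₀ hA hADt hr hlo hhi hρ ϑ₀ θ (m := ⊤)) 4
  refine ⟨hB.comp hS, fun i hi => ?_⟩
  -- chart distance to the forward configuration, scale floor, pointwise majorants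
  set dang := min |ϑ₀| |ϑ₀ - 2 * π| with hdangdef
  have hdang0 : 0 ≤ dang := le_min (abs_nonneg _) (abs_nonneg _)
  set δ := |ρ| + dang with hδdef
  have hδ0 : 0 ≤ δ := by positivity
  set m := max (c₁ * δ) Λ with hmdef
  have hm0 : 0 < m := lt_max_of_lt_right hΛ
  have hmΛ : Λ ≤ m := le_max_right _ _
  have hcomp : c * δ ≤ ‖pairDiffPath μ K ρ ϑ₀ θ 0‖ := norm_pairDiffPath_zero_ge hA hA20 hd hr hlo hhi hA₃ hA₄ hρ hϑ₀Icc θ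
  have hm_le : m ≤ max (c' * ‖pairDiffPath μ K ρ ϑ₀ θ 0‖) Λ :=
    max_le_max (by rw [hc₁def, mul_assoc]; exact mul_le_mul_of_nonneg_left hcomp hc'.le) le_rfl
  set M : ℕ → ℝ := fun k => if k = 0 then Cb0 else Cb / m ^ k with hMdef
  set D : ℕ → ℝ := fun i => ‖iteratedDeriv i (pairDiffPath μ K ρ ϑ₀ θ) 0‖ with hDdef
  have hMk : ∀ k, 1 ≤ k → k ≤ 4 → ‖iteratedFDeriv ℝ k Bf (pairDiffPath μ K ρ ϑ₀ θ 0)‖ ≤ M k := by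
    intro k hk1 hk4
    have hk0 : k ≠ 0 := by omega
    simp only [hMdef, hk0, if_false]
    refine (hBk _ k hk1 hk4).trans ?_
    rw [div_eq_mul_inv]
    refine mul_le_mul_of_nonneg_left ?_ hCb
    exact inv_anti₀ (pow_pos hm0 k) (pow_le_pow_left₀ hm0.le hm_le k)
  have hM0 : ‖Bf (pairDiffPath μ K ρ ϑ₀ θ 0)‖ ≤ M 0 := by simp only [hMdef, if_true]; exact hB0 _
  have hDi : ∀ i, 1 ≤ i → i ≤ 4 → ‖iteratedDeriv i (pairDiffPath μ K ρ ϑ₀ θ) 0‖ ≤ D i := fun i _ _ => le_rfl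
  have hbell := norm_iteratedDeriv_comp_le_bell4_complex hB hS hMk hM0 hDi hi
  -- rigidity at the forward configuration, in the `min` form
  have hrig : ∀ i, i ≤ 3 → ∀ Lr : ℝ,
      (∀ s : ℝ, ‖iteratedDeriv i (levelPoint μ K ρ) s - iteratedDeriv i (levelPoint μ K 0) s‖ ≤ Lr) → D i ≤ Lr + msD A₃ A₄ (i + 1) * dang := by
    intro i hi3 Lr hLr
    have h1 := norm_iteratedDeriv_pairDiffPath_le_rigid hA hA20 hd hr hlo hhi hA₃ hA₄ hρ hi3 hLr ϑ₀ θ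
    have h2 := norm_iteratedDeriv_pairDiffPath_le_rigid' hA hA20 hd hr hlo hhi hA₃ hA₄ hρ hi3 hLr ϑ₀ θ
    show ‖iteratedDeriv i (pairDiffPath μ K ρ ϑ₀ θ) 0‖ ≤ Lr + msD A₃ A₄ (i + 1) * dang
    rcases le_total |ϑ₀| |ϑ₀ - 2 * π| with h | h
    · rw [hdangdef, min_eq_left h]; exact h1
    · rw [hdangdef, min_eq_right h]; exact h2
  have hLδ : L * δ ≤ x * m := by
    have h := mul_max_le (δ := δ) (Λ := Λ) hc₁0 hL0
    rwa [← hxdef, ← hmdef] at h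
  have hDs : ∀ i, 1 ≤ i → i ≤ 3 → D i ≤ x * m := by
    intro i hi1 hi3
    refine le_trans ?_ hLδ
    interval_cases i
    · refine (hrig 1 (by norm_num) _ (fun s => norm_iteratedDeriv_one_levelPoint_sub_le hA hd hr hlo hhi hρ s)).trans ?_
      rw [hδdef, mul_add]
      exact add_le_add (mul_le_mul_of_nonneg_right hL1a (abs_nonneg _)) (mul_le_mul_of_nonneg_right hL1b hdang0)
    · refine (hrig 2 (by norm_num) _ (hrow₂ ρ hρ)).trans ?_
      rw [hδdef, mul_add]
      exact add_le_add (mul_le_mul_of_nonneg_right hL2a (abs_nonneg _)) (mul_le_mul_of_nonneg_right hL2b hdang0)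
    · refine (hrig 3 (by norm_num) _ (hrow₃ ρ hρ)).trans ?_
      rw [hδdef, mul_add]
      exact add_le_add (mul_le_mul_of_nonneg_right hL3a (abs_nonneg _)) (mul_le_mul_of_nonneg_right hL3b hdang0)
  have hDs0 : ∀ i, 1 ≤ i → i ≤ 4 → 0 ≤ D i := fun i _ _ => norm_nonneg _
  have hMb0 : ∀ k, 1 ≤ k → k ≤ 4 → 0 ≤ M k := fun k hk1 hk4 => (norm_nonneg _).trans (hMk k hk1 hk4)
  have hMb : ∀ k, 1 ≤ k → k ≤ 4 → M k ≤ Cb / m ^ k := by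
    intro k hk1 _; have hk0 : k ≠ 0 := by omega
    simp only [hMdef, hk0, if_false, le_refl]
  obtain ⟨r1, r2, r3, r4⟩ := bell4_le_of_rigid hm0 hMb0 hMb hDs0 hDs
  have hD4 : D 4 ≤ 2 * msD A₃ A₄ 4 := norm_iteratedDeriv_pairDiffPath_le hA hA20 hd hr hlo hhi hA₃ hA₄ θ ρ ϑ₀ hρ 4 (by norm_num) le_rfl
  have hM1 : M 1 ≤ Cb / Λ := by
    have h1 : (1 : ℕ) ≠ 0 := one_ne_zero
    simp only [hMdef, h1, if_false, pow_one]
    exact div_le_div_of_nonneg_left hCb hΛ hmΛ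
  have hM1D4 : M 1 * D 4 ≤ Cb / Λ * (2 * msD A₃ A₄ 4) :=
    mul_le_mul hM1 hD4 (norm_nonneg _) (div_nonneg hCb hΛ.le)
  refine hbell.trans ?_
  interval_cases i
  · simp only [bell4, ppJetDominator, hMdef, if_true]; exact le_rfl
  · simp only [ppJetDominator]; linarith
  · simp only [ppJetDominator]; linarith
  · simp only [ppJetDominator]; linarith
  · simp only [ppJetDominator]; linarith

end Sizes

end Summit.HubbardSuperconductivity.HubbardSuperconductivity.Theorems.C4a

end
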